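import Summits.NavierStokesRegularity.NavierStokesRegularity.Theses.HardyPointSink
import Summits.NavierStokesRegularity.NavierStokesRegularity.Theorems.HardyPointSinkHardyEnergyBoundRegularInflux
import Summits.NavierStokesRegularity.NavierStokesRegularity.Theorems.HardyPointSinkHardyEnergyBoundIff
import HarnessLib

/-!
# Route HardyPointSink — crux `HardyEnergyBound` (item stmt-NavierStokesRegularity-7979):
# the heart needs proving only at the backward singular centres

Support file (theorems only, `--supports stmt-NavierStokesRegularity-7979`; lead c7 of the crux
line, 2026-08-17).  The registered heart of line `birth`, `stub_influxAbsorption` (≡ the crux,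
`hardyEnergyBound_iff_influxAbsorption`, p153587), asks at EVERY centre `x_*` for a scale `R` and a
remainder `M` with `ofReal(−2I(x₀;T−R²,t)) ≤ D(x₀;T−R²,t) + M` for all sinks `x₀ ∈ B(x_*, R/4)` and
`t < T`.  By `headInflux_le_of_not_isBackwardSingularPoint` (`…RegularInflux`) this holds with room
— the influx itself is bounded above — at every centre `x_*` with `(T, x_*)` NOT a backward singular
point of the Kato solution.  Hence:

* `influxAbsorption_of_at_backwardSingularPoints` — the heart follows from its restriction to the
  centres `x_*` with `(T, x_*)` a backward singular point (where, by `…DivergentInflux` and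
  `…RegularTopBounds`, both currencies `−2I` and `D` diverge);
* `hardyEnergyBound_iff_influxAbsorption_at_backwardSingularPoints` — **the crux is equivalent to
  the absorption inequality AT THE BACKWARD SINGULAR CENTRES ONLY** (with c3's
  `hardyEnergyBound_iff_at_backwardSingularPoints`, the same reduction for the crux itself).

So a future line for this crux proves: at a backward singular point `(T, x_*)` of a Kato solution
from a Clay datum, the divergent head influx toward the sinks near `x_*` exceeds the divergent
Hardy dissipation plus point sink by at most a constant.

References: L. Caffarelli, R. Kohn, L. Nirenberg, Comm. Pure Appl. Math. 35 (1982), §2, §8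
[CKN1982].
-/

-- the problem directory repeats the summit name (D-0017); core's `dupNamespace` linter fires
set_option linter.dupNamespace false

noncomputable section

open Set MeasureTheory Filter Topology TopologicalSpace Function Metric Module
open scoped ENNReal NNReal
open Literature.Analysis.FluidPDE

namespace Summit.NavierStokesRegularity.NavierStokesRegularity.Theorems

/-! ### The heart at the backward singular centres implies the heart -/

/-- **The heart of line `birth` needs proving only at the backward singular centres.**  If the
influx-absorption inequality `ofReal(−2I) ≤ D + M` (registered signature of `stub_influxAbsorption`)
holds near every centre `x_*` with `(T, x_*)` a BACKWARD SINGULAR point of the Kato solution, then it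
holds near every centre: at a non-singular `(T, x_*)` the cumulative head influx toward every sink
`x₀ ∈ B(x_*, R/4)` is bounded above by some `M` up to the final time
(`headInflux_le_of_not_isBackwardSingularPoint`), and `ofReal(−2I) ≤ ofReal M ≤ D + M⁺`.
[cite: CaffarelliKohnNirenberg1982, §2 and §8] -/
theorem influxAbsorption_of_at_backwardSingularPoints
    (h : ∀ ν : ℝ, 0 < ν → ∀ u₀ : EuclideanSpace ℝ (Fin 3) → EuclideanSpace ℝ (Fin 3),
      ContDiff ℝ (⊤ : ℕ∞) u₀ → Literature.Analysis.FluidPDE.NSWave0.IsDivFree u₀ →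
      Literature.Analysis.FluidPDE.HasRapidSpatialDecay u₀ →
      ∀ (T : ℝ) (u : ℝ → EuclideanSpace ℝ (Fin 3) → EuclideanSpace ℝ (Fin 3)), 0 < T →
      Literature.Analysis.FluidPDE.IsKatoSolutionOn T ν u₀ u →
      ∀ (v : ℝ → EuclideanSpace ℝ (Fin 3) → EuclideanSpace ℝ (Fin 3))
        (p : ℝ → EuclideanSpace ℝ (Fin 3) → ℝ),
      Literature.Analysis.FluidPDE.IsClassicalNSSolutionOn (Set.Ioo 0 T) ν 0 v p →
      (∀ t ∈ Set.Ioo 0 T, v t =ᵐ[MeasureTheory.volume] u t) →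
      ∀ xs : EuclideanSpace ℝ (Fin 3),
        Literature.Analysis.FluidPDE.IsBackwardSingularPoint u
          ((T, xs) : ℝ × EuclideanSpace ℝ (Fin 3)) →
        ∃ R : ℝ, 0 < R ∧ R ^ 2 < T ∧
      ∃ M : NNReal, ∀ x₀ ∈ Metric.ball xs (R / 4), ∀ t ∈ Set.Ico (T - R ^ 2) T,
        ENNReal.ofReal (-2 * ∫ s in (T - R ^ 2)..t, ∫ x in Metric.ball xs R,
              (‖v s x‖ ^ 2 / 2 + Literature.Analysis.FluidPDE.rieszPressure (v s) x)
                * inner ℝ (v s x) (x - x₀) / ‖x - x₀‖ ^ 3)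
        ≤ (∫⁻ s in Set.Ioo (T - R ^ 2) t,
              (ENNReal.ofReal (2 * ν)
                  * (∫⁻ x in Metric.ball xs (R / 2),
                      ENNReal.ofReal (Literature.Analysis.FluidPDE.frobeniusNormSq (fderiv ℝ (v s) x))
                        / ‖x - x₀‖ₑ)
                + ENNReal.ofReal (4 * Real.pi * ν) * ‖v s x₀‖ₑ ^ 2))
          + (M : ENNReal)) :
    ∀ ν : ℝ, 0 < ν → ∀ u₀ : EuclideanSpace ℝ (Fin 3) → EuclideanSpace ℝ (Fin 3),
      ContDiff ℝ (⊤ : ℕ∞) u₀ → Literature.Analysis.FluidPDE.NSWave0.IsDivFree u₀ →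
      Literature.Analysis.FluidPDE.HasRapidSpatialDecay u₀ →
      ∀ (T : ℝ) (u : ℝ → EuclideanSpace ℝ (Fin 3) → EuclideanSpace ℝ (Fin 3)), 0 < T →
      Literature.Analysis.FluidPDE.IsKatoSolutionOn T ν u₀ u →
      ∀ (v : ℝ → EuclideanSpace ℝ (Fin 3) → EuclideanSpace ℝ (Fin 3))
        (p : ℝ → EuclideanSpace ℝ (Fin 3) → ℝ),
      Literature.Analysis.FluidPDE.IsClassicalNSSolutionOn (Set.Ioo 0 T) ν 0 v p →
      (∀ t ∈ Set.Ioo 0 T, v t =ᵐ[MeasureTheory.volume] u t) →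
      ∀ xs : EuclideanSpace ℝ (Fin 3), ∃ R : ℝ, 0 < R ∧ R ^ 2 < T ∧
      ∃ M : NNReal, ∀ x₀ ∈ Metric.ball xs (R / 4), ∀ t ∈ Set.Ico (T - R ^ 2) T,
        ENNReal.ofReal (-2 * ∫ s in (T - R ^ 2)..t, ∫ x in Metric.ball xs R,
              (‖v s x‖ ^ 2 / 2 + Literature.Analysis.FluidPDE.rieszPressure (v s) x)
                * inner ℝ (v s x) (x - x₀) / ‖x - x₀‖ ^ 3)
        ≤ (∫⁻ s in Set.Ioo (T - R ^ 2) t,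
              (ENNReal.ofReal (2 * ν)
                  * (∫⁻ x in Metric.ball xs (R / 2),
                      ENNReal.ofReal (Literature.Analysis.FluidPDE.frobeniusNormSq (fderiv ℝ (v s) x))
                        / ‖x - x₀‖ₑ)
                + ENNReal.ofReal (4 * Real.pi * ν) * ‖v s x₀‖ₑ ^ 2))
          + (M : ENNReal) := by
  intro ν hν u₀ hsm hdiv hdec T u hT hu v p hcl hae xs
  by_cases hsing : IsBackwardSingularPoint u ((T, xs) : ℝ × EuclideanSpace ℝ (Fin 3))
  · exact h ν hν u₀ hsm hdiv hdec T u hT hu v p hcl hae xs hsing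
  · -- at a regular top point the influx itself is bounded above
    obtain ⟨R, hR, hRT, M, hM⟩ := headInflux_le_of_not_isBackwardSingularPoint hν hT hu hcl hae hsing
    refine ⟨R, hR, hRT, M.toNNReal, fun x₀ hx₀ t ht => ?_⟩
    calc ENNReal.ofReal (-2 * ∫ s in (T - R ^ 2)..t, ∫ x in Metric.ball xs R,
            (‖v s x‖ ^ 2 / 2 + rieszPressure (v s) x) * inner ℝ (v s x) (x - x₀) / ‖x - x₀‖ ^ 3)
        ≤ ENNReal.ofReal M := ENNReal.ofReal_le_ofReal (hM x₀ hx₀ t ht)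
      _ = (M.toNNReal : ℝ≥0∞) := rfl
      _ ≤ _ := le_add_self

/-! ### The crux is the heart at the backward singular centres -/

/-- **`HardyEnergyBound` ⟺ the influx-absorption inequality at the backward singular centres.**
The crux C2 is equivalent (`hardyEnergyBound_iff_influxAbsorption`, line `birth`) to the heart at
every centre; the heart at the non-singular centres is automatic
(`influxAbsorption_of_at_backwardSingularPoints`); so C2 is equivalent to: for every Kato
solution from a Clay datum, its classical representative `(v, p)` and every BACKWARD SINGULAR
point `(T, x_*)`, there are `0 < R`, `R² < T`, `M` with `ofReal(−2I(x₀;T−R²,t)) ≤ D(x₀;T−R²,t) + M`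
for all `x₀ ∈ B(x_*, R/4)`, `T − R² ≤ t < T` — an inequality between the two DIVERGENT currencies
of the point-sink ledger (`isBackwardSingularPoint_iff_headInflux_unbounded`,
`isBackwardSingularPoint_iff_hardyDissipation_eq_top`). [cite: CaffarelliKohnNirenberg1982, §2 and §8] -/
theorem hardyEnergyBound_iff_influxAbsorption_at_backwardSingularPoints :
    Summit.NavierStokesRegularity.NavierStokesRegularity.Theses.HardyPointSink.HardyEnergyBound ↔
    (∀ ν : ℝ, 0 < ν → ∀ u₀ : EuclideanSpace ℝ (Fin 3) → EuclideanSpace ℝ (Fin 3),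
      ContDiff ℝ (⊤ : ℕ∞) u₀ → Literature.Analysis.FluidPDE.NSWave0.IsDivFree u₀ →
      Literature.Analysis.FluidPDE.HasRapidSpatialDecay u₀ →
      ∀ (T : ℝ) (u : ℝ → EuclideanSpace ℝ (Fin 3) → EuclideanSpace ℝ (Fin 3)), 0 < T →
      Literature.Analysis.FluidPDE.IsKatoSolutionOn T ν u₀ u →
      ∀ (v : ℝ → EuclideanSpace ℝ (Fin 3) → EuclideanSpace ℝ (Fin 3))
        (p : ℝ → EuclideanSpace ℝ (Fin 3) → ℝ),
      Literature.Analysis.FluidPDE.IsClassicalNSSolutionOn (Set.Ioo 0 T) ν 0 v p →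
      (∀ t ∈ Set.Ioo 0 T, v t =ᵐ[MeasureTheory.volume] u t) →
      ∀ xs : EuclideanSpace ℝ (Fin 3),
        Literature.Analysis.FluidPDE.IsBackwardSingularPoint u
          ((T, xs) : ℝ × EuclideanSpace ℝ (Fin 3)) →
        ∃ R : ℝ, 0 < R ∧ R ^ 2 < T ∧
      ∃ M : NNReal, ∀ x₀ ∈ Metric.ball xs (R / 4), ∀ t ∈ Set.Ico (T - R ^ 2) T,
        ENNReal.ofReal (-2 * ∫ s in (T - R ^ 2)..t, ∫ x in Metric.ball xs R,
              (‖v s x‖ ^ 2 / 2 + Literature.Analysis.FluidPDE.rieszPressure (v s) x)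
                * inner ℝ (v s x) (x - x₀) / ‖x - x₀‖ ^ 3)
        ≤ (∫⁻ s in Set.Ioo (T - R ^ 2) t,
              (ENNReal.ofReal (2 * ν)
                  * (∫⁻ x in Metric.ball xs (R / 2),
                      ENNReal.ofReal (Literature.Analysis.FluidPDE.frobeniusNormSq (fderiv ℝ (v s) x))
                        / ‖x - x₀‖ₑ)
                + ENNReal.ofReal (4 * Real.pi * ν) * ‖v s x₀‖ₑ ^ 2))
          + (M : ENNReal)) := by
  constructor
  · intro hE ν hν u₀ hsm hdiv hdec T u hT hu v p hcl hae xs _hsing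
    exact hardyEnergyBound_influxAbsorption_of_crux hE ν hν u₀ hsm hdiv hdec T u hT hu v p hcl hae xs
  · intro h
    exact hardyEnergyBound_of_influxAbsorption (influxAbsorption_of_at_backwardSingularPoints h)

end Summit.NavierStokesRegularity.NavierStokesRegularity.Theorems

end
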